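import Mathlib
import Summits.ValiantsHypothesis.ValiantsHypothesis.Theorems.BinomialElusiveNoShortRelations

/-!
# ValiantsHypothesis / BinomialElusive — relations of SMALL SUPPORT among the carry-free exponents

A strengthening of `NoShortRelations` (stmt-ValiantsHypothesis-7395, `noShortRelations_proof`: no nonzero
relation of LENGTH `≤ h`) recorded for the peeling arguments of crux `BinomialCandidate`
(stmt-ValiantsHypothesis-7392, line `registered`, lead c2 STRUCTURE-c2.md §1): the exponents
`E(j) = Σ_{k ≤ h} (j M)^k`, `M = (2m+2)^{h+1}`, admit no nonzero integer relation `Σ_j w_j E(j+1) = 0`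
whose SUPPORT has at most `h + 1` indices, as soon as its length `Σ_j |w_j|` is at most `2m + 1`
(so that no carries occur).  In particular an "honest" even cycle of length `≤ h + 1` in a valuation
graph, or any configuration of `≤ h + 1` exponents with coefficients summing to `≤ 2m + 1` in absolute
value, is impossible — length up to `2m + 1` instead of `h`.

Proof: as for `noShortRelations_proof` — the base-`M` digits `d_k = Σ_j w_j (j+1)^k` satisfy
`|d_k| ≤ (2m+1)(2m)^h < (2m+2)^{h+1} = M`, so they all vanish (`digits_eq_zero`), and the Vandermonde
system on the support (now of size `≤ h + 1`, with the `h + 1` digits `k = 0, …, h`) forces `w = 0`.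
-/

namespace Summit.ValiantsHypothesis.ValiantsHypothesis.Theorems.BinomialElusiveNoShortRelations

-- summit = sub-problem name (single-conjunct summit, D-0017 layout), so the namespace repeats it
set_option linter.dupNamespace false

open scoped BigOperators
open Finset

/-- The digit bound without the factor `h`: `(2m+1) (2m)^h < (2m+2)^(h+1)`. -/
theorem succ_mul_pow_lt_base (m h : ℕ) : (2 * m + 1) * (2 * m) ^ h < (2 * m + 2) ^ (h + 1) := by
  calc (2 * m + 1) * (2 * m) ^ h ≤ (2 * m + 1) * (2 * m + 2) ^ h :=
        Nat.mul_le_mul_left _ (Nat.pow_le_pow_left (by omega) h)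
    _ < (2 * m + 2) * (2 * m + 2) ^ h :=
        Nat.mul_lt_mul_of_pos_right (by omega) (by positivity)
    _ = (2 * m + 2) ^ (h + 1) := by ring

/-- **Relations of small support.**  For all `m, h` and `w : Fin (2m) → ℤ` with `Σ_j |w_j| ≤ 2m + 1`
and at most `h + 1` nonzero entries, `Σ_j w_j E(j+1) = 0` forces `w = 0`, where
`E(j) = Σ_{k ≤ h} (j (2m+2)^{h+1})^k`. -/
theorem noRelation_of_small_support :
    ∀ (m h : ℕ) (w : Fin (2 * m) → ℤ), ∑ j, |w j| ≤ 2 * (m : ℤ) + 1 →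
      (Finset.univ.filter (fun j => w j ≠ 0)).card ≤ h + 1 →
      ∑ j, w j * ((∑ k ∈ Finset.range (h + 1), (((j : ℕ) + 1) * (2 * m + 2) ^ (h + 1)) ^ k : ℕ) : ℤ) = 0 →
      w = 0 := by
  intro m h w hw hcard hrel
  -- §1: the relation is a base-`M` expansion with digits `d_k = Σ_j w_j (j+1)^k`.
  have hdigits : ∑ k ∈ Finset.range (h + 1),
      (∑ j : Fin (2 * m), w j * (((j : ℕ) : ℤ) + 1) ^ k) * ((2 * (m : ℤ) + 2) ^ (h + 1)) ^ k = 0 := by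
    have key : ∀ j : Fin (2 * m), (w j : ℤ) * ((∑ k ∈ Finset.range (h + 1),
        (((j : ℕ) + 1) * (2 * m + 2) ^ (h + 1)) ^ k : ℕ) : ℤ)
        = ∑ k ∈ Finset.range (h + 1),
            w j * (((j : ℕ) : ℤ) + 1) ^ k * ((2 * (m : ℤ) + 2) ^ (h + 1)) ^ k := by
      intro j
      push_cast
      rw [Finset.mul_sum]
      exact Finset.sum_congr rfl fun k _ => by rw [mul_pow, ← mul_assoc]
    rw [Finset.sum_congr rfl (fun j _ => key j), Finset.sum_comm] at hrel
    simpa only [Finset.sum_mul] using hrel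
  -- §2: every digit is smaller than the base in absolute value (length `≤ 2m+1`, no factor `h`).
  have hbound : ∀ k < h + 1,
      |∑ j : Fin (2 * m), w j * (((j : ℕ) : ℤ) + 1) ^ k| < (2 * (m : ℤ) + 2) ^ (h + 1) := by
    intro k hk
    have hk' : k ≤ h := Nat.lt_succ_iff.mp hk
    calc |∑ j : Fin (2 * m), w j * (((j : ℕ) : ℤ) + 1) ^ k|
        ≤ ∑ j : Fin (2 * m), |w j * (((j : ℕ) : ℤ) + 1) ^ k| := Finset.abs_sum_le_sum_abs _ _
      _ ≤ ∑ j : Fin (2 * m), |w j| * (2 * (m : ℤ)) ^ h := by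
          refine Finset.sum_le_sum fun j _ => ?_
          rw [abs_mul]
          refine mul_le_mul_of_nonneg_left ?_ (abs_nonneg _)
          have hj : (((j : ℕ) : ℤ) + 1) ≤ 2 * (m : ℤ) := by have := j.isLt; omega
          have hj0 : (0 : ℤ) ≤ ((j : ℕ) : ℤ) + 1 := by positivity
          rw [abs_of_nonneg (pow_nonneg hj0 _)]
          calc (((j : ℕ) : ℤ) + 1) ^ k ≤ (2 * (m : ℤ)) ^ k := pow_le_pow_left₀ hj0 hj k
            _ ≤ (2 * (m : ℤ)) ^ h := pow_le_pow_right₀ (by have := j.isLt; omega) hk'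
      _ = (∑ j : Fin (2 * m), |w j|) * (2 * (m : ℤ)) ^ h := (Finset.sum_mul _ _ _).symm
      _ ≤ (2 * (m : ℤ) + 1) * (2 * (m : ℤ)) ^ h := mul_le_mul_of_nonneg_right hw (by positivity)
      _ < (2 * (m : ℤ) + 2) ^ (h + 1) := by exact_mod_cast succ_mul_pow_lt_base m h
  -- §3: all digits vanish.
  have hzero : ∀ k < h + 1, (∑ j : Fin (2 * m), w j * (((j : ℕ) : ℤ) + 1) ^ k) = 0 :=
    digits_eq_zero ((2 * (m : ℤ) + 2) ^ (h + 1)) (by positivity) (h + 1)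
      (fun k => ∑ j : Fin (2 * m), w j * (((j : ℕ) : ℤ) + 1) ^ k) hbound hdigits
  -- §4: Vandermonde on the support of `w` (size `≤ h + 1`, digits `k = 0, …, h`).
  funext j₀
  rw [Pi.zero_apply]
  by_contra hj₀
  set s : Finset (Fin (2 * m)) := Finset.univ.filter (fun j => w j ≠ 0) with hs
  have hmem : ∀ j, j ∈ s ↔ w j ≠ 0 := fun j => by simp [hs]
  obtain ⟨e⟩ : Nonempty (Fin s.card ≃ {x // x ∈ s}) := ⟨s.equivFin.symm⟩
  have hf : Function.Injective (fun i : Fin s.card => (((e i : Fin (2 * m)) : ℕ) : ℤ) + 1) := by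
    intro a b hab
    have hab' : (((e a : Fin (2 * m)) : ℕ) : ℤ) + 1 = (((e b : Fin (2 * m)) : ℕ) : ℤ) + 1 := hab
    exact e.injective (Subtype.ext (Fin.ext (by exact_mod_cast (add_right_cancel hab'))))
  have hv : (fun i : Fin s.card => w (e i)) = 0 := by
    refine Matrix.eq_zero_of_forall_pow_sum_mul_pow_eq_zero hf fun i => ?_
    show ∑ j : Fin s.card, w (e j) * ((((e j : Fin (2 * m)) : ℕ) : ℤ) + 1) ^ (i : ℕ) = 0
    have h1 : ∑ j : Fin s.card, w (e j) * ((((e j : Fin (2 * m)) : ℕ) : ℤ) + 1) ^ (i : ℕ)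
        = ∑ x : {x // x ∈ s}, w x * ((((x : Fin (2 * m)) : ℕ) : ℤ) + 1) ^ (i : ℕ) :=
      Fintype.sum_equiv e _ _ fun _ => rfl
    have h2 : ∑ x ∈ s, w x * (((x : ℕ) : ℤ) + 1) ^ (i : ℕ)
        = ∑ x, w x * (((x : ℕ) : ℤ) + 1) ^ (i : ℕ) := by
      refine Finset.sum_subset (Finset.subset_univ _) fun x _ hx => ?_
      have hx' : w x = 0 := by simpa [hmem] using hx
      simp [hx']
    rw [h1, Finset.sum_coe_sort s (fun x => w x * (((x : ℕ) : ℤ) + 1) ^ (i : ℕ)), h2]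
    exact hzero i (by have := i.isLt; omega)
  have hval := congr_fun hv (e.symm ⟨j₀, (hmem j₀).mpr hj₀⟩)
  simp only [Equiv.apply_symm_apply, Pi.zero_apply] at hval
  exact hj₀ hval

end Summit.ValiantsHypothesis.ValiantsHypothesis.Theorems.BinomialElusiveNoShortRelations
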